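import Summits.QuantumFields.BalabanUV.InfraRed.StrongCouplingStaggerPhaseWeights
import Summits.QuantumFields.BalabanUV.InfraRed.StrongCouplingWeightedForestDoor
import Summits.QuantumFields.BalabanUV.InfraRed.StrongCouplingQuarterModulusTwoSevenths
import Summits.QuantumFields.BalabanUV.InfraRed.StrongCouplingDoorCeilings
import HarnessLib

/-!
# The five-class weighted forest door: SC-b below `β_W = 200/723 = 0.2766…` (SU(2)), hypothesis-free

Observatory of the non-perturbative crossover; no mass-gap claim.

ABSOLUTE RULE of this package: no internally-minted statement enters as a cited fact; every hypothesis is either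
kernel-proved in this package or a verbatim quotation of a PUBLISHED theorem with page reference. The manuscript(s)
under audit are not citable for their own disputed steps. Everything below is assembled from kernel theorems of this
package over Mathlib's Haar measure; no literature axiom is invoked.

LEDGER CURRENCY: SC-b, `CrossoverLedger.StrongCouplingFront (fundamentalLatticeRep 2) (β₀W/2)` (uniform exponential
clustering of gauge-invariant local observables on all `[0, β₀W/2]`, odd tori `(ZMod (2S+1))^4`, every `S ≥ S₀`).
Units: tree coupling `β = β_W/2` for `SU(2)` (`UNITS.md`), `β_W = 4/g²`.

THE TABLE (W4b). Phase-class weights `phaseWeight (fiveU U₀ U₁) uT` on the staggered temporal forest: a space-like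
link of class `a` (the staggering phase of the site below it) weighs `U₀ = 1087/1000` for `a ∈ {0, 3}`,
`U₁ = 1093/1000` for `a ∈ {1, 2}` and `1` otherwise; a time-like link weighs `uT = 4523/5000`. With `ρ = 723/50 = 14.46`
the row conditions of `StrongCouplingStaggerPhaseWeights.weightedRow_phase_le` hold on every odd torus of side
`L ≥ 11` (`fiveClass_rows`: finitely many integer cases `z = valMinAbs a ∈ [−2, 5]` plus the far classes, where the
row is `14 ≤ ρ`; time-like rows `6 (U₀ + U₁) = 13.08 ≤ ρ uT = 13.0805…`). The optimum of this five-class family is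
`ρ* = 14.4594…`; wider windows give `14.42 … 14.14` (not done here).

CONSEQUENCE. Through the weighted forest door (`StrongCouplingWeightedForestDoor.su2_weightedForestDoor`, weights in
`[uT, U₁]`) and the quarter modulus up to `2/7` (`(33·4)`): **SC-b at every Wilson `β₀W < 4/ρ = 200/723 = 0.27662…`**
(`su2_strongCouplingFront_lt_fiveClass`; was `5000/18513 = 0.27008` two-class, `4/15` uniform), instance `β_W = 0.276`,
bare coupling `g² > 723/50 = 14.46`; the ceiling is a theorem (`su2_fiveClassDoor_iff`). Gain over `4/15`: `+3.73 %`.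

NOT CLAIMED: SC-b at or above `β_W = 200/723`; any DLR statement (SC-a stays `β_W < 2/9`); SC-c is `β_W < 2/7`
elsewhere; N ≥ 3; no mass-gap claim.  All (K)-grade: kernel theorems over Mathlib's Haar measure, hypothesis-free.
-/

noncomputable section

open Literature.MathematicalPhysics.QuantumFieldTheory
open Literature.MathematicalPhysics.QuantumLattice (fundamentalRep fundamentalLatticeRep)
open Literature.MathematicalPhysics.QuantumFieldTheory.Balaban1983to89
open Literature.MathematicalPhysics.QuantumFieldTheory.Balaban1983to89.StrongCouplingDobrushinWindow
open Summit.QuantumFields.BalabanUV.InfraRed.StrongCouplingForestGauge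
open Summit.QuantumFields.BalabanUV.InfraRed.StrongCouplingStaggerForest
open Summit.QuantumFields.BalabanUV.InfraRed.StrongCouplingWeightedFrozenCovariance (WeightedForestRowBound)
open Summit.QuantumFields.BalabanUV.InfraRed.StrongCouplingWeightedForestDoor (su2_weightedForestDoor)
open Summit.QuantumFields.BalabanUV.InfraRed.StrongCouplingStaggerPhaseWeights
open Summit.QuantumFields.BalabanUV.InfraRed.StrongCouplingQuarterModulusTwoSevenths (oneLinkKRModulusSU2_of_le_twoSevenths)
open Summit.QuantumFields.BalabanUV.InfraRed.StrongCouplingDoorCeilings (door_iff)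

namespace Summit.QuantumFields.BalabanUV.InfraRed.StrongCouplingFiveClassFront

/-! ## 1. The five-class table on `ZMod L` -/

section Table

variable {L : ℕ} [NeZero L]

/-- **Five-class space-like weights** by staggering-phase class: `U₀` on classes `0, 3`, `U₁` on classes `1, 2`,
`1` elsewhere. [folklore] -/
def fiveU (U₀ U₁ : ℝ) (a : ZMod L) : ℝ := if a = 0 ∨ a = 3 then U₀ else if a = 1 ∨ a = 2 then U₁ else 1

/-- A residue equals a small integer `c` (`|c| ≤ 5`, `L ≥ 11`) iff its least-absolute-value lift is `c`. [folklore] -/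
theorem eq_intCast_iff_valMinAbs (hL : 11 ≤ L) (a : ZMod L) (c : ℤ) (hc : -5 ≤ c ∧ c ≤ 5) :
    a = (c : ZMod L) ↔ a.valMinAbs = c := by
  rw [ZMod.valMinAbs_spec]
  constructor
  · intro h
    refine ⟨h, ?_, ?_⟩ <;> omega
  · exact fun h => h.1

omit [NeZero L] in
/-- The table values on the window. [folklore] -/
theorem fiveU_window (hL : 4 ≤ L) (U₀ U₁ : ℝ) :
    fiveU U₀ U₁ (0 : ZMod L) = U₀ ∧ fiveU U₀ U₁ (1 : ZMod L) = U₁ ∧ fiveU U₀ U₁ (2 : ZMod L) = U₁ ∧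
      fiveU U₀ U₁ (3 : ZMod L) = U₀ := by
  obtain ⟨h01, h02, h03, h12, h13, h23⟩ := zmod_small_ne hL
  refine ⟨by simp [fiveU], ?_, ?_, by simp [fiveU]⟩
  · simp [fiveU, h01.symm, h13]
  · simp [fiveU, h02.symm, h23, h12.symm]

set_option maxHeartbeats 400000 in
/-- **The five-class row conditions at `ρ = 723/50`** (`L ≥ 11`): for every class `a`,
`4u(a−2) + 4u(a) + 4u(a+2) + u(a+1) + u(a−1) + ([a=2]+[a=0]+[a=3]+[a=1]) uT ≤ ρ u(a)` with
`u = fiveU (1087/1000) (1093/1000)`, `uT = 4523/5000` — eight integer cases `valMinAbs a ∈ [−2, 5]` and the far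
classes. [folklore] -/
theorem fiveClass_rows (hL : 11 ≤ L) (a : ZMod L) :
    4 * fiveU (1087 / 1000) (1093 / 1000) (a - 2) + 4 * fiveU (1087 / 1000) (1093 / 1000) a +
        4 * fiveU (1087 / 1000) (1093 / 1000) (a + 2) + fiveU (1087 / 1000) (1093 / 1000) (a + 1) +
        fiveU (1087 / 1000) (1093 / 1000) (a - 1) +
      ((if a = 2 then (4523 / 5000 : ℝ) else 0) + (if a = 0 then (4523 / 5000 : ℝ) else 0) +
        (if a = 3 then (4523 / 5000 : ℝ) else 0) + (if a = 1 then (4523 / 5000 : ℝ) else 0)) ≤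
      723 / 50 * fiveU (1087 / 1000) (1093 / 1000) a := by
  have im2 : a = -2 ↔ a.valMinAbs = -2 := by simpa using eq_intCast_iff_valMinAbs hL a (-2) (by norm_num)
  have im1 : a = -1 ↔ a.valMinAbs = -1 := by simpa using eq_intCast_iff_valMinAbs hL a (-1) (by norm_num)
  have i0 : a = 0 ↔ a.valMinAbs = 0 := (ZMod.valMinAbs_eq_zero a).symm
  have i1 : a = 1 ↔ a.valMinAbs = 1 := by simpa using eq_intCast_iff_valMinAbs hL a 1 (by norm_num)
  have i2 : a = 2 ↔ a.valMinAbs = 2 := by simpa using eq_intCast_iff_valMinAbs hL a 2 (by norm_num)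
  have i3 : a = 3 ↔ a.valMinAbs = 3 := by simpa using eq_intCast_iff_valMinAbs hL a 3 (by norm_num)
  have i4 : a = 4 ↔ a.valMinAbs = 4 := by simpa using eq_intCast_iff_valMinAbs hL a 4 (by norm_num)
  have i5 : a = 5 ↔ a.valMinAbs = 5 := by simpa using eq_intCast_iff_valMinAbs hL a 5 (by norm_num)
  have s20 : a - 2 = 0 ↔ a = 2 := by constructor <;> intro h <;> linear_combination h
  have s23 : a - 2 = 3 ↔ a = 5 := by constructor <;> intro h <;> linear_combination h
  have s21 : a - 2 = 1 ↔ a = 3 := by constructor <;> intro h <;> linear_combination h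
  have s22 : a - 2 = 2 ↔ a = 4 := by constructor <;> intro h <;> linear_combination h
  have p20 : a + 2 = 0 ↔ a = -2 := by constructor <;> intro h <;> linear_combination h
  have p23 : a + 2 = 3 ↔ a = 1 := by constructor <;> intro h <;> linear_combination h
  have p21 : a + 2 = 1 ↔ a = -1 := by constructor <;> intro h <;> linear_combination h
  have p22 : a + 2 = 2 ↔ a = 0 := by constructor <;> intro h <;> linear_combination h
  have p10 : a + 1 = 0 ↔ a = -1 := by constructor <;> intro h <;> linear_combination h
  have p13 : a + 1 = 3 ↔ a = 2 := by constructor <;> intro h <;> linear_combination h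
  have p11 : a + 1 = 1 ↔ a = 0 := by constructor <;> intro h <;> linear_combination h
  have p12 : a + 1 = 2 ↔ a = 1 := by constructor <;> intro h <;> linear_combination h
  have s10 : a - 1 = 0 ↔ a = 1 := by constructor <;> intro h <;> linear_combination h
  have s13 : a - 1 = 3 ↔ a = 4 := by constructor <;> intro h <;> linear_combination h
  have s11 : a - 1 = 1 ↔ a = 2 := by constructor <;> intro h <;> linear_combination h
  have s12 : a - 1 = 2 ↔ a = 3 := by constructor <;> intro h <;> linear_combination h
  simp only [fiveU, s20, s23, s21, s22, p20, p23, p21, p22, p10, p13, p11, p12, s10, s13, s11, s12, im2, im1, i0, i1,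
    i2, i3, i4, i5]
  generalize a.valMinAbs = z
  by_cases hz : -2 ≤ z ∧ z ≤ 5
  · obtain ⟨hz1, hz2⟩ := hz
    interval_cases z <;> norm_num
  · have f0 : z ≠ -2 := by omega
    have f1 : z ≠ -1 := by omega
    have f2 : z ≠ 0 := by omega
    have f3 : z ≠ 1 := by omega
    have f4 : z ≠ 2 := by omega
    have f5 : z ≠ 3 := by omega
    have f6 : z ≠ 4 := by omega
    have f7 : z ≠ 5 := by omega
    simp only [f0, f1, f2, f3, f4, f5, f6, f7, or_false, if_false]
    norm_num

omit [NeZero L] in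
/-- The table is nonnegative and lies in `[4523/5000, 1093/1000]` together with `uT = 4523/5000`. [folklore] -/
theorem fiveU_mem (a : ZMod L) :
    1 ≤ fiveU (1087 / 1000) (1093 / 1000) a ∧ fiveU (1087 / 1000) (1093 / 1000) a ≤ 1093 / 1000 := by
  unfold fiveU
  split_ifs <;> constructor <;> norm_num

/-- **W4b as a `WeightedForestRowBound`** at `ρ = 723/50` on every torus of side `L ≥ 11`, with the weights in
`[4523/5000, 1093/1000]`. [folklore] -/
theorem weightedForestRowBound_fiveClass (hL : 11 ≤ L) :
    WeightedForestRowBound (staggerForest L)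
        (phaseWeight (fiveU (1087 / 1000) (1093 / 1000)) (4523 / 5000)) (723 / 50) ∧
      (∀ y : Edge 4 L, (4523 / 5000 : ℝ) ≤ phaseWeight (fiveU (1087 / 1000) (1093 / 1000)) (4523 / 5000 : ℝ) y) ∧
      ∀ y : Edge 4 L, phaseWeight (fiveU (1087 / 1000) (1093 / 1000)) (4523 / 5000 : ℝ) y ≤ (1093 / 1000 : ℝ) := by
  have hL4 : 4 ≤ L := by omega
  obtain ⟨w0, w1, w2, w3⟩ := fiveU_window hL4 (1087 / 1000 : ℝ) (1093 / 1000)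
  have hu : ∀ a : ZMod L, 0 ≤ fiveU (1087 / 1000) (1093 / 1000) a := fun a => by linarith [(fiveU_mem a).1]
  refine ⟨fun e he => weightedRow_phase_le hL4 hu (by norm_num) (M := 218 / 100) (by norm_num)
    (by rw [w0, w1]; norm_num) (by rw [w2, w3]; norm_num) (by norm_num) (fiveClass_rows hL) e he, fun y => ?_,
    fun y => ?_⟩
  · unfold phaseWeight; split_ifs
    · exact le_rfl
    · linarith [(fiveU_mem (L := L) (stagPhase y.1 - 1)).1]
  · unfold phaseWeight; split_ifs
    · norm_num
    · exact (fiveU_mem (L := L) (stagPhase y.1 - 1)).2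

end Table

/-! ## 2. The five-class door and the owned numbers -/

/-- **The five-class weighted forest door** (`SU(2)`): every `0 ≤ β₀W ≤ 2/7` with `(723/50) β₀W (1/4) < 1` carries the
strong-coupling front (SC-b) — staggered forests with five-class phase weights (W4b) on the odd tori of side `≥ 11`,
the proved gauge fixing and weighted frozen clustering (W3b), the quarter modulus up to `2/7`. [folklore] -/
theorem su2_strongCouplingFront_of_fiveClass {β₀W : ℝ} (h27 : β₀W ≤ 2 / 7) (hsmall : 723 / 50 * β₀W * (1 / 4) < 1) :
    CrossoverLedger.StrongCouplingFront (fundamentalLatticeRep 2) (β₀W / 2) :=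
  su2_weightedForestDoor (ρ := 723 / 50) (vmin := 4523 / 5000) (vmax := 1093 / 1000) (by norm_num) (by norm_num)
    (by norm_num) (fun S => staggerForest (2 * S + 1)) (fun _ => stagRank)
    (fun _ => phaseWeight (fiveU (1087 / 1000) (1093 / 1000)) (4523 / 5000)) 5
    (fun S hS => ⟨isRankedForest_stagger (by omega), weightedForestRowBound_fiveClass (by omega)⟩)
    (oneLinkKRModulusSU2_of_le_twoSevenths h27) hsmall

/-- **SC-b BELOW `200/723 = 0.27662…`, HYPOTHESIS-FREE** (was `5000/18513 = 0.27008` two-class, `4/15` uniform): the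
`SU(2)` strong-coupling front at every Wilson `β₀W < 200/723` (tree coupling `β₀W/2 < 100/723`; vacuous for `β₀W < 0`),
through the five-class weighted forest door at `ρ = 723/50`. [folklore] -/
theorem su2_strongCouplingFront_lt_fiveClass {β₀W : ℝ} (hlt : β₀W < 200 / 723) :
    CrossoverLedger.StrongCouplingFront (fundamentalLatticeRep 2) (β₀W / 2) :=
  su2_strongCouplingFront_of_fiveClass (by linarith) (by linarith)

/-- Instance: **SC-b AT Wilson `β_W = 0.276`** (tree coupling `0.138`; `0.276 < 200/723`). [folklore] -/
theorem su2_strongCouplingFront_0276 :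
    CrossoverLedger.StrongCouplingFront (fundamentalLatticeRep 2) ((276 / 1000 : ℝ) / 2) :=
  su2_strongCouplingFront_lt_fiveClass (by norm_num)

/-- SC-b in the bare coupling: every `g² > 723/50 = 14.46` (`β_W = 4/g² < 200/723`) carries the `SU(2)` strong-coupling
front (was `g² > 14.8104`). [folklore] -/
theorem su2_strongCouplingFront_of_bareCoupling {gsq : ℝ} (hg : 723 / 50 < gsq) :
    CrossoverLedger.StrongCouplingFront (fundamentalLatticeRep 2) ((4 / gsq) / 2) := by
  have hg0 : 0 < gsq := lt_trans (by norm_num) hg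
  refine su2_strongCouplingFront_lt_fiveClass ?_
  rw [div_lt_iff₀ hg0]
  linarith

/-- **The five-class door's ceiling is a theorem**: with the quarter modulus below `2/7` the door at `ρ = 723/50` opens
(some admissible `K₂`) exactly on `[0, 200/723)`. [folklore] -/
theorem su2_fiveClassDoor_iff {βW : ℝ} (h0 : 0 ≤ βW) :
    (∃ K₂ : ℝ, 0 ≤ K₂ ∧ OneLinkKRModulusSU2 βW K₂ ∧ 723 / 50 * βW * K₂ < 1) ↔ βW < 200 / 723 := by
  have h := door_iff (D := 723 / 50) (by norm_num)
    (fun b _ hb => oneLinkKRModulusSU2_of_le_twoSevenths (by rw [div_div_eq_mul_div] at hb; linarith)) h0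
  rw [h, div_div_eq_mul_div]
  norm_num

/-- The numbers side by side: `4/15 < 5000/18513 < 0.276 < 200/723 < 2/7`, and `200/723 = 4/(723/50)`. [folklore] -/
theorem fiveClass_window_numbers :
    (4 : ℝ) / 15 < 5000 / 18513 ∧ (5000 : ℝ) / 18513 < 276 / 1000 ∧ (276 : ℝ) / 1000 < 200 / 723 ∧
      (200 : ℝ) / 723 < 2 / 7 ∧ (200 : ℝ) / 723 = 4 / (723 / 50) := by
  norm_num

end Summit.QuantumFields.BalabanUV.InfraRed.StrongCouplingFiveClassFront
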